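import Summits.NavierStokesRegularity.TurbBounds.Results.S50
import Summits.NavierStokesRegularity.TurbBounds.ShearPolyBridge
import Summits.NavierStokesRegularity.TurbBounds.Certs.S50.ModeForm1
import Summits.NavierStokesRegularity.TurbBounds.Certs.S50.ModeForm2
import HarnessLib

/-!
# Row R2-50: the polynomial positivity of the two certified modes DISCHARGED — the row from the cited reduction ALONE
(cell `pub-turb` / `turb-bounds`, shear lane; v2, written by pub-turb-shear gen 7, 2026-08-22. Lands after `Results/S50`, `ShearPolyBridge` and the
Ca items `Certs/S50/ModeForm1,2` (gen 6).)

HONEST FRAMING: rigorous bounds for the stated PDE and boundary conditions; no claim about physical turbulence beyond the bound.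
`polyPositivity_holds : Results.S50.PolyPositivityS50` — for each certified mode `m = 1, 2` (`N = 12`, `P = 4`) and every polynomial pair with the wall
conditions, the relaxed per-mode form with the cell's constants is `≥ 0`: `ShearPolyBridge.shearForm_poly_decomp` writes it as the right-hand side of
`Certs.S50.ModeForm.M<m>.modeForm_nonneg` (landed evaluator `EvalBlock<m>.rule_posSemidef` + generator-C identities `SpecPieces<m>` + landed
`TailSlack` + the sequence-level tail lemma), whose coupling-remainder hypothesis is `ShearPolyBridge.tailX_bound`.
CONSEQUENCE (`surfaceVelocity_bound_of_reduction`, `ceps_bound_of_reduction`): for every `ū` with `FW16Reduction 2 50 ū` — the cited background-method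
reduction of Fantuzzi–Wynn (2016) §2 / Hagstrom–Doering (2014), the ONLY hypothesis — `49.999999998 ≤ U ≤ ū` and `C_ε = 50/ū² ≤ 0.020000000002`
(CERTIFIED.md row R2-50). Everything else — the LMI certificate of the two modes, the generator identities, the tail lemma, the cross-term split, the
cutoff `m ≥ 3`, the rational relaxation, density, and the profile arithmetic — is kernel-checked.
-/

set_option linter.style.longLine false

noncomputable section

namespace Summit.NavierStokesRegularity.TurbBounds.Results.S50

open Polynomial intervalIntegral MeasureTheory Set Finset Literature.Analysis.SpecialFunctions
open Summit.NavierStokesRegularity.TurbBounds.LadderTail (w w_pos IsLadder)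
open Summit.NavierStokesRegularity.TurbBounds.LegendreCoeffs
open Summit.NavierStokesRegularity.TurbBounds.ShearForm
open Summit.NavierStokesRegularity.TurbBounds.ShearPolyBridge
open Summit.NavierStokesRegularity.TurbBounds.ShearSpecPieces
open Summit.NavierStokesRegularity.TurbBounds.Certs.S50

/-! ## 1. The two certified modes -/

/-- **Mode 1 of R2-50 (`N = 12`, `P = 4`) on polynomial pairs.** -/
theorem polyPositivity_mode1 (Up Vp : ℝ[X]) (hU0 : Up.eval (-1) = 0) (hU1 : (derivative Up).eval (-1) = 0) (hU2 : Up.eval 1 = 0)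
    (hV0 : Vp.eval (-1) = 0) (hV1 : (derivative Vp).eval (-1) = 0) (hV2 : Vp.eval 1 = 0) :
    0 ≤ shearForm (Acell (Scalars.Gx : ℝ) 1) (Ccell (Scalars.Gx : ℝ) 1) (Dcell (Scalars.Gx : ℝ) 1)
      (fun x => profileS50.eval x) (fun x => Up.eval x) (fun x => Vp.eval x) := by
  set L := max Up.natDegree Vp.natDegree + 1 with hL
  have hLU : Up.natDegree < L := by omega
  have hLV : Vp.natDegree < L := by omega
  have hphi : ∀ p, p < 4 + 1 → ModeForm.M1.phi p = phiS50 p := by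
    intro p hp; unfold ModeForm.M1.phi phiS50; interval_cases p <;> rfl
  have hprof : profileS50 = gpOf 4 ModeForm.M1.phi := by
    unfold profileS50 gpOf; exact sum_congr rfl fun p hp => by rw [hphi p (mem_range.mp hp)]
  have eA : Acell (Scalars.Gx : ℝ) 1 = ((Am Scalars.Gx SpecPieces.M1.piHi 1 : ℚ) : ℝ) := by rw [Acell_cast]; rfl
  rw [eA, Ccell_cast Scalars.Gx Scalars.piLo rfl, Dcell_cast Scalars.Gx Scalars.piLo rfl, hprof,
    shearForm_poly_decomp 12 4 _ _ _ ModeForm.M1.phi Up Vp hU0 hU1 hV0 hV1 L hLU hLV]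
  obtain ⟨hA₁, h0a₁, hB₁, hw₁⟩ := wall_data Up hU0 hU1 hU2
  obtain ⟨hA₂, h0a₂, hB₂, hw₂⟩ := wall_data Vp hV0 hV1 hV2
  have hT : ∀ x ∈ Icc (-1 : ℝ) 1, |(gpOf 4 ModeForm.M1.phi).eval x| ≤ (Scalars.T : ℝ) := by
    rw [← hprof]; exact profileS50_abs_le
  have hX := tailX_bound 12 4 ModeForm.M1.phi Up Vp hT L hLU hLV (delta_cast_pos 12)
  exact ModeForm.M1.modeForm_nonneg hA₁ h0a₁ hB₁ hw₁ hA₂ h0a₂ hB₂ hw₂ L hX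

/-- **Mode 2 of R2-50 (`N = 12`, `P = 4`) on polynomial pairs.** -/
theorem polyPositivity_mode2 (Up Vp : ℝ[X]) (hU0 : Up.eval (-1) = 0) (hU1 : (derivative Up).eval (-1) = 0) (hU2 : Up.eval 1 = 0)
    (hV0 : Vp.eval (-1) = 0) (hV1 : (derivative Vp).eval (-1) = 0) (hV2 : Vp.eval 1 = 0) :
    0 ≤ shearForm (Acell (Scalars.Gx : ℝ) 2) (Ccell (Scalars.Gx : ℝ) 2) (Dcell (Scalars.Gx : ℝ) 2)
      (fun x => profileS50.eval x) (fun x => Up.eval x) (fun x => Vp.eval x) := by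
  set L := max Up.natDegree Vp.natDegree + 1 with hL
  have hLU : Up.natDegree < L := by omega
  have hLV : Vp.natDegree < L := by omega
  have hphi : ∀ p, p < 4 + 1 → ModeForm.M2.phi p = phiS50 p := by
    intro p hp; unfold ModeForm.M2.phi phiS50; interval_cases p <;> rfl
  have hprof : profileS50 = gpOf 4 ModeForm.M2.phi := by
    unfold profileS50 gpOf; exact sum_congr rfl fun p hp => by rw [hphi p (mem_range.mp hp)]
  have eA : Acell (Scalars.Gx : ℝ) 2 = ((Am Scalars.Gx SpecPieces.M2.piHi 2 : ℚ) : ℝ) := by rw [Acell_cast]; rfl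
  rw [eA, Ccell_cast Scalars.Gx Scalars.piLo rfl, Dcell_cast Scalars.Gx Scalars.piLo rfl, hprof,
    shearForm_poly_decomp 12 4 _ _ _ ModeForm.M2.phi Up Vp hU0 hU1 hV0 hV1 L hLU hLV]
  obtain ⟨hA₁, h0a₁, hB₁, hw₁⟩ := wall_data Up hU0 hU1 hU2
  obtain ⟨hA₂, h0a₂, hB₂, hw₂⟩ := wall_data Vp hV0 hV1 hV2
  have hT : ∀ x ∈ Icc (-1 : ℝ) 1, |(gpOf 4 ModeForm.M2.phi).eval x| ≤ (Scalars.T : ℝ) := by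
    rw [← hprof]; exact profileS50_abs_le
  have hX := tailX_bound 12 4 ModeForm.M2.phi Up Vp hT L hLU hLV (delta_cast_pos 12)
  exact ModeForm.M2.modeForm_nonneg hA₁ h0a₁ hB₁ hw₁ hA₂ h0a₂ hB₂ hw₂ L hX

/-- **`PolyPositivityS50`, PROVED.** -/
theorem polyPositivity_holds : PolyPositivityS50 := by
  intro m hm hle Up Vp hU0 hU1 hU2 hV0 hV1 hV2
  have hle' : m ≤ 2 := by simpa [Scalars.mCert] using hle
  interval_cases m
  · exact polyPositivity_mode1 Up Vp hU0 hU1 hU2 hV0 hV1 hV2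
  · exact polyPositivity_mode2 Up Vp hU0 hU1 hU2 hV0 hV1 hV2

/-! ## 2. Row R2-50 from the cited reduction alone (parameters as literals: `Γx = 2`, `Gr = 50`) -/

/-- FW16's spectral constraint for the certified profile of R2-50, every mode `m ≥ 1`, the whole admissible `C²` class — UNCONDITIONAL. -/
theorem fw16Positivity_holds : FW16Positivity (2 : ℝ) (fun x => profileS50.eval x) := by
  have hGx : ((Scalars.Gx : ℚ) : ℝ) = 2 := by norm_num [Scalars.Gx]
  rw [← hGx]; exact fw16Positivity_of_polyPositivity polyPositivity_holds

/-- **Row R2-50, mean surface velocity, from ONE named hypothesis**: `FW16Reduction 2 50 ū → U ≤ ū` (`U = Scalars.U ≥ 49.999999998`). -/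
theorem surfaceVelocity_bound_of_reduction (ubar : ℝ) (hRed : FW16Reduction (2 : ℝ) 50 ubar) : (Scalars.U : ℝ) ≤ ubar := by
  have hGx : ((Scalars.Gx : ℚ) : ℝ) = 2 := by norm_num [Scalars.Gx]
  have hGr : ((Scalars.Gr : ℚ) : ℝ) = 50 := by norm_num [Scalars.Gr]
  rw [← hGx, ← hGr] at hRed
  exact surfaceVelocity_bound ubar hRed polyPositivity_holds

/-- **Row R2-50, dissipation coefficient, from ONE named hypothesis**: `FW16Reduction 2 50 ū → 50/ū² ≤ Scalars.Ceps`. -/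
theorem ceps_bound_of_reduction (ubar : ℝ) (hRed : FW16Reduction (2 : ℝ) 50 ubar) : (50 : ℝ) / ubar ^ 2 ≤ (Scalars.Ceps : ℝ) := by
  have hGx : ((Scalars.Gx : ℚ) : ℝ) = 2 := by norm_num [Scalars.Gx]
  have hGr : ((Scalars.Gr : ℚ) : ℝ) = 50 := by norm_num [Scalars.Gr]
  rw [← hGx, ← hGr] at hRed
  rw [← hGr]
  exact ceps_bound ubar hRed polyPositivity_holds

/-- … with the outward decimal of CERTIFIED.md row R2-50: `C_ε ≤ 0.020000000002`. -/
theorem ceps_bound_decimal_of_reduction (ubar : ℝ) (hRed : FW16Reduction (2 : ℝ) 50 ubar) :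
    (50 : ℝ) / ubar ^ 2 ≤ (10000000001 : ℝ) / 500000000000 := by
  have hGx : ((Scalars.Gx : ℚ) : ℝ) = 2 := by norm_num [Scalars.Gx]
  have hGr : ((Scalars.Gr : ℚ) : ℝ) = 50 := by norm_num [Scalars.Gr]
  rw [← hGx, ← hGr] at hRed
  rw [← hGr]
  exact ceps_bound_decimal ubar hRed polyPositivity_holds

/-- Vacuity guard, now unconditional: the hypothesis is not provable for every `ū` (`ū = 0` fails). -/
theorem fw16Reduction_nontrivial_holds : ¬ FW16Reduction (2 : ℝ) 50 0 := by
  have hGx : ((Scalars.Gx : ℚ) : ℝ) = 2 := by norm_num [Scalars.Gx]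
  have hGr : ((Scalars.Gr : ℚ) : ℝ) = 50 := by norm_num [Scalars.Gr]
  rw [← hGx, ← hGr]
  exact fw16Reduction_nontrivial polyPositivity_holds

end Summit.NavierStokesRegularity.TurbBounds.Results.S50

end
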